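import Summits.Ventures.PercRepro.Night2BasisLevelOne

/-!
# night-2: the refined structure of a loaded target — distance one or the covered fallback

`exists_pair_of_dload_ne_zero` (p670721) names a lossy big pair `(B, z)` with `S = Q_b ∪ {x}` (`x` a good point)
or `S = Q_b ∪ {p.1, p.2}` (a distance-2 pair).  The rule `dshGT2` takes the distance-2 fallback ONLY when the pair
has no good point, so the refined disjunction holds (`exists_pair_of_dload_ne_zero'`): either `S = Q_b ∪ {x}` with
a good point `x` (and the pair has good points), or `S = Q_b ∪ {p.1, p.2}` and the pair has NO good point.
With `card_coloops_eq_three_of_loss_ne_zero` (a lossy big set has exactly three coloops off `K`) this gives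
(`loaded_target_line`): a loaded target `T` contains a rank-`2` set `R` (the non-coloop part of `Q_b ∖ K`) with
`|R| = |T ∖ K| − 4` at a distance-1 target and `|R| = |T ∖ K| − 5` at a distance-2 one — the line structure of
the loaded targets above a basis (paper `proofs/NIGHT-2-g32.md` §3.4: at level `j` a distance-1 loaded target has
`≥ j − 1` of its `j` points on one line).
-/

namespace PercRepro.Shadow

open PercRepro.ThmH PercRepro.PerFlat

variable {α : Type*} [DecidableEq α] {M : Matroid α} [M.Finite] {G : Finset α}

/-- **The refined source of a loaded target**: a lossy big pair with `S` a good target (the pair has good points) or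
a distance-2 target (the pair has NO good point). -/
theorem exists_pair_of_dload_ne_zero' (hG : G ∈ flatsQ M (5 + 1)) (hd : (gr M \ G).card = 2)
    (hk : kColoops M G = 1) (hs : ∀ e ∈ gr M, ∀ f ∈ gr M, e ≠ f → rkN M {e, f} = 2)
    (hl : ∀ e ∈ gr M, M.Indep {e}) (hfat : (fatClosures M 5 G 2).card ≤ 1) {S : Finset α}
    (hne : dload M 5 G (bigP M G) (dshGT2 M 5 G) S ≠ 0) :
    ∃ B ∈ thinMembers M 5 G, 5 ≤ (B \ coloops M G).card ∧ ∃ z ∈ G \ clF M B, loss M 5 G B z ≠ 0 ∧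
      (((gtPts M 5 G (insert z B)).Nonempty ∧
          ∃ x ∈ gtPts M 5 G (insert z B), S = insert x (insert z B)) ∨
        (¬ (gtPts M 5 G (insert z B)).Nonempty ∧
          ∃ p ∈ d2Pts M 5 G (insert z B), S = insert p.1 (insert p.2 (insert z B)))) := by
  unfold dload at hne
  obtain ⟨B, hBf, hB1⟩ := Finset.exists_ne_zero_of_sum_ne_zero hne
  obtain ⟨z, hz, hz1⟩ := Finset.exists_ne_zero_of_sum_ne_zero hB1
  rw [Finset.mem_filter] at hBf
  obtain ⟨hB, hbig⟩ := hBf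
  have hloss : loss M 5 G B z ≠ 0 := fun h0 => hz1 (dshGT2_eq_zero_of_loss_eq_zero h0 S)
  refine ⟨B, hB, hbig, z, hz, hloss, ?_⟩
  unfold dshGT2 at hz1
  split_ifs at hz1 with h1 h2 h3 h4
  · left
    refine ⟨h1, ?_⟩
    unfold gtTargets at h2
    rw [Finset.mem_image] at h2
    obtain ⟨x, hx, hxS⟩ := h2
    exact ⟨x, hx, hxS.symm⟩
  · exact absurd rfl hz1
  · right
    refine ⟨h1, ?_⟩
    unfold d2Targets at h4
    rw [Finset.mem_image] at h4
    obtain ⟨p, hp, hpS⟩ := h4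
    exact ⟨p, hp, hpS.symm⟩
  · exact absurd rfl hz1
  · -- the third tier never fires: a lossy big pair without good points has at least eight distance-2 targets
    exfalso
    apply h3
    have h8 := eight_le_card_d2Targets hG hd hk hs hl hfat hB hbig hz hloss h1
    rw [← Finset.card_pos]
    omega

/-- A lossy big set `Q_b ∖ K` is three coloops plus a rank-`2` set of `|Q_b ∖ K| − 3` points. -/
theorem exists_rank_two_of_loss_ne_zero (hG : G ∈ flatsQ M (5 + 1)) (hd : (gr M \ G).card = 2)
    (hk : kColoops M G = 1) (hs : ∀ e ∈ gr M, ∀ f ∈ gr M, e ≠ f → rkN M {e, f} = 2)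
    (hl : ∀ e ∈ gr M, M.Indep {e}) {B : Finset α} (hB : B ∈ thinMembers M 5 G)
    (hbig : 5 ≤ (B \ coloops M G).card) {z : α} (hz : z ∈ G \ clF M B) (h : loss M 5 G B z ≠ 0) :
    ∃ R ⊆ insert z B \ coloops M G, rkN M R = 2 ∧ R.card + 3 = (insert z B \ coloops M G).card := by
  have hGg : G ⊆ gr M := (mem_flatsQ.1 hG).1
  have hQG : insert z B ⊆ G :=
    Finset.insert_subset (Finset.mem_sdiff.1 hz).1 (subset_G_of_mem_thinMembers hB)
  set Q' := insert z B \ coloops M G with hQ'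
  have hQ'g : Q' ⊆ gr M := Finset.sdiff_subset.trans (hQG.trans hGg)
  have hc3 : (coloops M Q').card = 3 := card_coloops_eq_three_of_loss_ne_zero hG hd hk hs hl hB hbig hz h
  have h5 : rkN M Q' = 5 := rkN_insert_sdiff_coloops_eq_five_of_thin hG hd hk hB hz
  have hsplit := eRk_eq_card_coloops_add_sdiff (M := M) hQ'g
  rw [eRk_eq_rkN, eRk_eq_rkN, h5, hc3] at hsplit
  have hrk : rkN M (Q' \ coloops M Q') = 2 := by
    have : ((5 : ℕ) : ℕ∞) = ((3 : ℕ) : ℕ∞) + ((rkN M (Q' \ coloops M Q') : ℕ) : ℕ∞) := hsplit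
    rw [← Nat.cast_add] at this
    have := Nat.cast_injective (R := ℕ∞) this
    omega
  refine ⟨Q' \ coloops M Q', Finset.sdiff_subset, hrk, ?_⟩
  have hKsub : coloops M Q' ⊆ Q' := fun y hy => (mem_coloops.1 hy).1
  rw [Finset.card_sdiff_of_subset hKsub, hc3]
  have : 3 ≤ Q'.card := by
    have := Finset.card_le_card hKsub
    omega
  omega

/-- **The line of a loaded target**: `T` contains a rank-`2` set `R ⊆ T ∖ K` with `|R| + 4 = |T ∖ K|` (a distance-1
target of a lossy big pair) or `|R| + 5 = |T ∖ K|` (a distance-2 target of a lossy big pair without good points). -/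
theorem loaded_target_line (hG : G ∈ flatsQ M (5 + 1)) (hd : (gr M \ G).card = 2) (hk : kColoops M G = 1)
    (hs : ∀ e ∈ gr M, ∀ f ∈ gr M, e ≠ f → rkN M {e, f} = 2) (hl : ∀ e ∈ gr M, M.Indep {e})
    (hfat : (fatClosures M 5 G 2).card ≤ 1) {T : Finset α}
    (hne : dload M 5 G (bigP M G) (dshGT2 M 5 G) T ≠ 0) :
    ∃ R ⊆ T \ coloops M G, rkN M R = 2 ∧
      (R.card + 4 = (T \ coloops M G).card ∨ R.card + 5 = (T \ coloops M G).card) := by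
  have hd' : (gr M \ G).card ≤ 5 := by omega
  obtain ⟨B, hB, hbig, z, hz, hloss, hcase⟩ := exists_pair_of_dload_ne_zero' hG hd hk hs hl hfat hne
  obtain ⟨R, hRQ, hR2, hRcard⟩ := exists_rank_two_of_loss_ne_zero hG hd hk hs hl hB hbig hz hloss
  have hKB : coloops M G ⊆ B := coloops_subset_of_mem_thinMembers hG hd' hB
  have hQ'T : ∀ {S : Finset α}, insert z B ⊆ S → insert z B \ coloops M G ⊆ S \ coloops M G :=
    fun hsub => Finset.sdiff_subset_sdiff hsub (Finset.Subset.refl _)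
  rcases hcase with ⟨-, x, hx, rfl⟩ | ⟨-, p, hp, rfl⟩
  · have hxQ : x ∉ insert z B := notMem_of_mem_goodPts hx
    have hxK : x ∉ coloops M G := fun h => hxQ (Finset.mem_insert_of_mem (hKB h))
    refine ⟨R, hRQ.trans (hQ'T (Finset.subset_insert _ _)), hR2, Or.inl ?_⟩
    have : insert x (insert z B) \ coloops M G = insert x (insert z B \ coloops M G) := by
      ext e
      simp only [Finset.mem_sdiff, Finset.mem_insert]
      constructor
      · rintro ⟨h1 | h1, h2⟩
        · exact Or.inl h1
        · exact Or.inr ⟨h1, h2⟩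
      · rintro (rfl | ⟨h1, h2⟩)
        · exact ⟨Or.inl rfl, hxK⟩
        · exact ⟨Or.inr h1, h2⟩
    rw [this, Finset.card_insert_of_notMem (fun h => hxQ (Finset.mem_sdiff.1 h).1)]
    omega
  · obtain ⟨⟨hp1, hp2⟩, hp12, -⟩ := mem_d2Pts.1 hp
    have hp1Q : p.1 ∉ insert z B := (Finset.mem_sdiff.1 hp1).2
    have hp2Q : p.2 ∉ insert z B := (Finset.mem_sdiff.1 hp2).2
    have hp1K : p.1 ∉ coloops M G := fun h => hp1Q (Finset.mem_insert_of_mem (hKB h))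
    have hp2K : p.2 ∉ coloops M G := fun h => hp2Q (Finset.mem_insert_of_mem (hKB h))
    refine ⟨R, hRQ.trans (hQ'T ((Finset.subset_insert _ _).trans (Finset.subset_insert _ _))), hR2, Or.inr ?_⟩
    have : insert p.1 (insert p.2 (insert z B)) \ coloops M G =
        insert p.1 (insert p.2 (insert z B \ coloops M G)) := by
      ext e
      simp only [Finset.mem_sdiff, Finset.mem_insert]
      constructor
      · rintro ⟨h1 | h1 | h1, h2⟩
        · exact Or.inl h1
        · exact Or.inr (Or.inl h1)
        · exact Or.inr (Or.inr ⟨h1, h2⟩)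
      · rintro (rfl | rfl | ⟨h1, h2⟩)
        · exact ⟨Or.inl rfl, hp1K⟩
        · exact ⟨Or.inr (Or.inl rfl), hp2K⟩
        · exact ⟨Or.inr (Or.inr h1), h2⟩
    rw [this, Finset.card_insert_of_notMem, Finset.card_insert_of_notMem (fun h => hp2Q (Finset.mem_sdiff.1 h).1)]
    · omega
    · rw [Finset.mem_insert, Finset.mem_sdiff]
      rintro (h | ⟨h, -⟩)
      · exact hp12 h
      · exact hp1Q h

end PercRepro.Shadow
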